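import Summits.BirchSwinnertonDyer.BirchSwinnertonDyer.Theorems.CyclotomicUntwistGNineConverseCubic
import Summits.BirchSwinnertonDyer.BirchSwinnertonDyer.Theorems.CyclotomicUntwistGNineConverseNine
import HarnessLib

/-!
# Preliminaries for the Galois-orbit argument (converse of `GNineCriterion`, route
# `CyclotomicUntwist`, crux K1 stmt-BirchSwinnertonDyer-21580)

HONEST FRAMING. Helper theorems only (`--supports stmt-BirchSwinnertonDyer-21580`); nothing about BSD.
Small lemmas used by `…GNineConverseOrbit`: cube and square roots in the value group `ℤᵐ⁰`,
`Gal(F/ℚ)` maps approximate roots of an integer cubic to approximate roots (Galois invariance of the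
place above `3` of a ninth cyclotomic field), transfer of approximate roots along small
perturbations, and exponent bookkeeping. [folklore]
-/

noncomputable section

open scoped NumberField

open IsDedekindDomain IsDedekindDomain.HeightOneSpectrum NumberField WithZero
  Literature.NumberTheory.LFunctions

-- D-0017 layout: summit = sub-problem ⇒ namespace `Summit.BirchSwinnertonDyer.BirchSwinnertonDyer.…`.
set_option linter.dupNamespace false

namespace Summit.BirchSwinnertonDyer.BirchSwinnertonDyer.Theorems.GNineConverse

section Prelim

variable {F : Type} [Field F] [NumberField F] [hF : IsCyclotomicExtension {3 ^ (1 + 1)} ℚ F]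
  (w : HeightOneSpectrum (𝓞 F)) (hw : (3 : 𝓞 F) ∈ w.asIdeal)

/-- Cube roots in `ℤᵐ⁰`: `x³ = exp(−6v)` forces `x = exp(−2v)`. [folklore] -/
theorem eq_exp_of_pow_three_eq {x : ℤᵐ⁰} {v : ℕ} (h : x ^ 3 = exp (-(6 * (v : ℤ)))) :
    x = exp (-(2 * (v : ℤ))) := by
  have hx : x ≠ 0 := by
    rintro rfl; rw [zero_pow three_ne_zero] at h; exact exp_ne_zero h.symm
  rw [← exp_log hx] at h ⊢
  rw [← exp_nsmul, exp_inj] at h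
  rw [exp_inj]
  simp only [nsmul_eq_mul, Nat.cast_ofNat] at h
  omega

/-- Square roots in `ℤᵐ⁰`: `x² ≤ exp(−2v)` forces `x ≤ exp(−v)`. [folklore] -/
theorem le_exp_of_sq_le {x : ℤᵐ⁰} {v : ℕ} (h : x ^ 2 ≤ exp (-(2 * (v : ℤ)))) : x ≤ exp (-(v : ℤ)) := by
  by_cases hx : x = 0
  · rw [hx]; exact zero_le
  rw [← exp_log hx] at h ⊢
  rw [← exp_nsmul, exp_le_exp] at h
  rw [exp_le_exp]
  simp only [nsmul_eq_mul, Nat.cast_ofNat] at h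
  omega

include hw

/-- `Gal(F/ℚ)` maps approximate roots to approximate roots: `w(f(σR)) = w(f(R))` for an integer
cubic. [folklore] -/
theorem val_eval_algEquiv (σ : F ≃ₐ[ℚ] F) (A B C : ℤ) (R : F) :
    w.valuation F ((σ R) ^ 3 + A * (σ R) ^ 2 + B * (σ R) + C) =
      w.valuation F (R ^ 3 + A * R ^ 2 + B * R + C) := by
  have e : (σ R) ^ 3 + (A : F) * (σ R) ^ 2 + B * (σ R) + C = σ (R ^ 3 + A * R ^ 2 + B * R + C) := by
    simp only [map_add, map_mul, map_pow, map_intCast]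
  rw [e, valuation_algEquiv w hw]

omit hF hw in
/-- Transfer of approximate roots: `w(f(Y)) ≤ max(w(f(X)), w(Y − X))` for integral data
(`f(Y) − f(X) = (Y − X)·Q(Y,X)` with `Q` integral). [folklore] -/
theorem val_eval_le_max (A B C : ℤ) {X Y : F} (hX : w.valuation F X ≤ 1) (hY : w.valuation F Y ≤ 1) :
    w.valuation F (Y ^ 3 + A * Y ^ 2 + B * Y + C) ≤
      max (w.valuation F (X ^ 3 + A * X ^ 2 + B * X + C)) (w.valuation F (Y - X)) := by
  have hA := GNineCriterion.val_intCast_le w A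
  have hB := GNineCriterion.val_intCast_le w B
  have e : Y ^ 3 + (A : F) * Y ^ 2 + B * Y + C =
      (X ^ 3 + A * X ^ 2 + B * X + C) + (Y - X) * (Y ^ 2 + Y * X + X ^ 2 + A * (Y + X) + B) := by
    ring
  have hQ : w.valuation F (Y ^ 2 + Y * X + X ^ 2 + A * (Y + X) + B) ≤ 1 := by
    refine Valuation.map_add_le _ (Valuation.map_add_le _ (Valuation.map_add_le _
      (Valuation.map_add_le _ ?_ ?_) ?_) ?_) hB
    · rw [Valuation.map_pow]; exact pow_le_one₀ zero_le hY
    · rw [Valuation.map_mul]; exact mul_le_one' hY hX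
    · rw [Valuation.map_pow]; exact pow_le_one₀ zero_le hX
    · rw [Valuation.map_mul]; exact mul_le_one' hA (Valuation.map_add_le _ hY hX)
  rw [e]
  refine le_trans (Valuation.map_add _ _ _) (max_le_max le_rfl ?_)
  rw [Valuation.map_mul]; exact mul_le_of_le_one_right' hQ

omit hF hw in
/-- `w(x)·t ≤ ε` with `t = exp(−k)` gives `w(x) ≤ ε·exp(k)`. [folklore] -/
theorem le_mul_exp_of_mul_exp_neg_le {x ε : ℤᵐ⁰} {k : ℤ} (h : x * exp (-k) ≤ ε) : x ≤ ε * exp k := by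
  have : x = x * exp (-k) * exp k := by rw [mul_assoc, ← exp_add]; simp
  rw [this]; exact mul_le_mul' h le_rfl

end Prelim

end Summit.BirchSwinnertonDyer.BirchSwinnertonDyer.Theorems.GNineConverse

end
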